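import Mathlib.RepresentationTheory.Homological.GroupCohomology.Functoriality
import Literature.AlgebraicGeometry.Frobenioids.PadicKummerActions
import Literature.AlgebraicGeometry.Frobenioids.PadicKummerContextIso
import Literature.AlgebraicGeometry.Frobenioids.KummerInflationTransportPair
import HarnessLib

/-!
# Frobenioids II, Theorem 2.4 (i): the comparison data induced by an isomorphism of the
# Definition 2.2 contexts (transport of structure)

Mochizuki, *The geometry of Frobenioids II*, Kyushu J. Math. **62** (2008) 401–460, §2, Theorem 2.4
(i) pp. 19–20 [cite: MochizukiFrdII2008, Thm 2.4 (i) p.19]. In print, an equivalence `Ψ : C₁ ⥲ C₂` of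
`p`-adic Frobenioids over an outer isomorphism `G₁ ⥲ G₂` mapping `H₁` onto `H₂` "induces
isomorphisms of monoids/modules `O^□(A₁)^{H₁} ⥲ O^□(A₂)^{H₂}`; `(H₁)_{A₁} ⥲ (H₂)_{A₂}`;
`(G₁)_{A₁} ⥲ (G₂)_{A₂}`; `H¹((H₁)_{A₁}, μ_N(A₁)) ⥲ H¹((H₂)_{A₂}, μ_N(A₂))`; `F_N(A₁) ⥲ F_N(A₂)`",
and "the remainder of assertion (i) follows immediately from the fact that `Ψ` preserves `O^⊳(−)`,
together with the manifestly group-theoretic/category-theoretic construction … of the Kummer and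
reciprocity maps" (proof, p. 20).

This file makes that sentence kernel-precise at the level of the typed data: from an isomorphism
`e : X₁.Iso X₂` of the Definition 2.2 contexts (abc-iut-L1-t7's `PadicKummer.Def22Context.Iso`:
what `Ψ`, `Ψ_Base` and "`Ψ` preserves `O^⊳(−)`" deliver on `Aut_C(Aᵢ)`, `O^□(Aᵢ)`, `Aut_E((Aᵢ)_E)`,
`Gᵢ ⊇ Hᵢ`) we CONSTRUCT the comparison data `e.thm24Data N : Thm24Data X₁ X₂ N` of
`PadicKummerSetting.lean` — `μ_N(A₁) ⥲ μ_N(A₂)` (`muIso`), `H¹` by functoriality of group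
cohomology (`isoH1`, Mathlib `groupCohomology.mapIso`), `F_N` by the two-group inflation transport of
`KummerInflationTransportPair.lean` (`transportMu`, `isoFN`) — and PROVE: `Ψ` "maps
`(N, H₁)`-saturated objects to `(N, H₂)`-saturated objects" (`isNHSaturated_iff`) and the
compatibility with the Kummer maps `isoH1 (κ_f) = κ_{isoO f}` (`isoH1_kummerClass`). The assembly of
`Thm24i` / `Thm24iExistsData` / `Thm24iActionCompat` from these (with the residual inputs `p₁ = p₂`,
"`Φ₁` fieldwise saturated iff `Φ₂`", and the functoriality of the local-duality isomorphism as named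
hypotheses) is in the companion `PadicKummerSettingProofs.lean`. Seat abc-iut-L1-d4 (gen 2); no item
of [FrdII] is restated here (the notions are abc-iut-L1-t7's).
-/

namespace Literature.AlgebraicGeometry.Frobenioids

namespace PadicKummer

open CategoryTheory groupCohomology Kummer

namespace Def22Context.Iso

variable {X₁ X₂ : Def22Context} (e : Def22Context.Iso X₁ X₂) (N : ℕ)

/-- `isoHA⁻¹` is `isoE⁻¹` on elements. [cite: MochizukiFrdII2008, Thm 2.4 (i) p.19] -/
@[simp] theorem coe_isoHA_symm (h : X₂.HA) :
    ((e.isoHA.symm h : X₁.HA) : X₁.AutE) = e.isoE.symm h := by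
  obtain ⟨h₁, rfl⟩ := e.isoHA.surjective h
  rw [MulEquiv.symm_apply_apply, coe_isoHA, MulEquiv.symm_apply_apply]

/-! ### `μ_N(A₁) ⥲ μ_N(A₂)` -/

/-- The isomorphism `μ_N(A₁) ⥲ μ_N(A₂)` of cyclotomic portions induced by `O^□(A₁) ⥲ O^□(A₂)`
(Thm. 2.4 (i): the coefficients of "`H¹((H₁)_{A₁}, μ_N(A₁)) ⥲ H¹((H₂)_{A₂}, μ_N(A₂))`").
[cite: MochizukiFrdII2008, Thm 2.4 (i) p.19] -/
def muIso : Mu N X₁.O ≃* Mu N X₂.O where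
  toFun ζ := Mu.mk (Units.map e.isoO.toMonoidHom ζ.val) (by
    have h := ζ.val_mem
    rw [mem_rootsOfUnity] at h ⊢
    rw [← map_pow, h, map_one])
  invFun ξ := Mu.mk (Units.map e.isoO.symm.toMonoidHom ξ.val) (by
    have h := ξ.val_mem
    rw [mem_rootsOfUnity] at h ⊢
    rw [← map_pow, h, map_one])
  left_inv ζ := Mu.ext (Units.ext (by simp))
  right_inv ξ := Mu.ext (Units.ext (by simp))
  map_mul' ζ ζ' := Mu.ext (by simp only [Mu.val_mk, Mu.val_mul, map_mul])

/-- `muIso` on underlying elements of `O^□(A₂)`. [cite: MochizukiFrdII2008, Thm 2.4 (i) p.19] -/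
@[simp] theorem coe_val_muIso (ζ : Mu N X₁.O) : ((e.muIso N ζ).val : X₂.O) = e.isoO (ζ.val : X₁.O) :=
  rfl

/-- `muIso⁻¹` on underlying elements of `O^□(A₁)`. [cite: MochizukiFrdII2008, Thm 2.4 (i) p.19] -/
@[simp] theorem coe_val_muIso_symm (ξ : Mu N X₂.O) :
    (((e.muIso N).symm ξ).val : X₁.O) = e.isoO.symm (ξ.val : X₂.O) :=
  rfl

/-- `muIso` is equivariant along `Aut_E((A₁)_E) ⥲ Aut_E((A₂)_E)`.
[cite: MochizukiFrdII2008, Thm 2.4 (i) p.19] -/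
theorem muIso_smul (τ : X₁.AutE) (ζ : Mu N X₁.O) : e.muIso N (τ • ζ) = e.isoE τ • e.muIso N ζ :=
  Mu.ext (Units.ext (by
    rw [coe_val_muIso, Mu.val_smul, coe_unitsAct, e.isoO_smul, Mu.val_smul, coe_unitsAct,
      coe_val_muIso]))

/-- `muIso⁻¹` is equivariant along `Aut_E((A₂)_E) ⥲ Aut_E((A₁)_E)`.
[cite: MochizukiFrdII2008, Thm 2.4 (i) p.19] -/
theorem muIso_symm_smul (τ : X₂.AutE) (ξ : Mu N X₂.O) :
    (e.muIso N).symm (τ • ξ) = e.isoE.symm τ • (e.muIso N).symm ξ := by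
  apply (e.muIso N).injective
  rw [MulEquiv.apply_symm_apply, muIso_smul, MulEquiv.apply_symm_apply, MulEquiv.apply_symm_apply]

/-- `muIso` is equivariant along `(H₁)_{A₁} ⥲ (H₂)_{A₂}`. [cite: MochizukiFrdII2008, Thm 2.4 (i) p.19] -/
theorem muIso_smul_HA (h : X₁.HA) (ζ : Mu N X₁.O) :
    e.muIso N (h • ζ) = e.isoHA h • e.muIso N ζ := by
  show e.muIso N (((h : X₁.HA) : X₁.AutE) • ζ) = ((e.isoHA h : X₂.HA) : X₂.AutE) • e.muIso N ζ
  rw [muIso_smul, coe_isoHA]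

/-- `muIso⁻¹` is equivariant along `(H₂)_{A₂} ⥲ (H₁)_{A₁}`. [cite: MochizukiFrdII2008, Thm 2.4 (i) p.19] -/
theorem muIso_symm_smul_HA (h : X₂.HA) (ξ : Mu N X₂.O) :
    (e.muIso N).symm (h • ξ) = e.isoHA.symm h • (e.muIso N).symm ξ := by
  show (e.muIso N).symm (((h : X₂.HA) : X₂.AutE) • ξ) =
    ((e.isoHA.symm h : X₁.HA) : X₁.AutE) • (e.muIso N).symm ξ
  rw [muIso_symm_smul, coe_isoHA_symm]

/-! ### `H¹((H₁)_{A₁}, μ_N(A₁)) ⥲ H¹((H₂)_{A₂}, μ_N(A₂))` -/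

/-- `μ_N(A₂) ⥲ μ_N(A₁)`, additively and `ℤ`-linearly (the coefficient isomorphism fed to Mathlib's
`groupCohomology.mapIso`). [cite: MochizukiFrdII2008, Thm 2.4 (i) p.19] -/
def muAddLinearEquiv : Additive (Mu N X₂.O) ≃ₗ[ℤ] Additive (Mu N X₁.O) :=
  (MulEquiv.toAdditive (e.muIso N).symm).toIntLinearEquiv

/-- `muAddLinearEquiv` on elements. [cite: MochizukiFrdII2008, Thm 2.4 (i) p.19] -/
@[simp] theorem muAddLinearEquiv_apply (x : Additive (Mu N X₂.O)) :
    e.muAddLinearEquiv N x = Additive.ofMul ((e.muIso N).symm (Additive.toMul x)) :=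
  rfl

/-- `muAddLinearEquiv⁻¹` on elements. [cite: MochizukiFrdII2008, Thm 2.4 (i) p.19] -/
@[simp] theorem muAddLinearEquiv_symm_apply (x : Additive (Mu N X₁.O)) :
    (e.muAddLinearEquiv N).symm x = Additive.ofMul (e.muIso N (Additive.toMul x)) :=
  rfl

/-- `muAddLinearEquiv` intertwines the `(H₂)_{A₂}`-action with the `(H₁)_{A₁}`-action along
`(H₂)_{A₂} ⥲ (H₁)_{A₁}`. [cite: MochizukiFrdII2008, Thm 2.4 (i) p.19] -/
theorem muAddLinearEquiv_comm (g : X₂.HA) :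
    (e.muAddLinearEquiv N).toLinearMap ∘ₗ (Rep.ofMulDistribMulAction X₂.HA (Mu N X₂.O)).ρ g =
      (Rep.ofMulDistribMulAction X₁.HA (Mu N X₁.O)).ρ (e.isoHA.symm g) ∘ₗ
        (e.muAddLinearEquiv N).toLinearMap := by
  apply LinearMap.ext
  intro (x : Additive (Mu N X₂.O))
  show Additive.ofMul ((e.muIso N).symm (Additive.toMul (Additive.ofMul
      (((g : X₂.HA) : X₂.AutE) • Additive.toMul x)))) =
    Additive.ofMul ((((e.isoHA.symm g) : X₁.HA) : X₁.AutE) • Additive.toMul (Additive.ofMul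
      ((e.muIso N).symm (Additive.toMul x))))
  rw [toMul_ofMul, toMul_ofMul, muIso_symm_smul, coe_isoHA_symm]

/-- The isomorphism `H¹((H₂)_{A₂}, μ_N(A₂)) ≅ H¹((H₁)_{A₁}, μ_N(A₁))` of group cohomology induced by
the pair `((H₂)_{A₂} ⥲ (H₁)_{A₁}, μ_N(A₂) ⥲ μ_N(A₁))` (Mathlib `groupCohomology.mapIso`).
[cite: MochizukiFrdII2008, Thm 2.4 (i) p.19] -/
noncomputable def h1Iso :
    groupCohomology (Rep.ofMulDistribMulAction X₂.HA (Mu N X₂.O)) 1 ≅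
      groupCohomology (Rep.ofMulDistribMulAction X₁.HA (Mu N X₁.O)) 1 :=
  groupCohomology.mapIso e.isoHA.symm (e.muAddLinearEquiv N) (e.muAddLinearEquiv_comm N) 1

/-- **Theorem 2.4 (i)**, the isomorphism `H¹((H₁)_{A₁}, μ_N(A₁)) ⥲ H¹((H₂)_{A₂}, μ_N(A₂))` induced by
the context isomorphism (Mathlib group cohomology of the discrete `(Hᵢ)_{Aᵢ}`, where the Kummer classes
live). [cite: MochizukiFrdII2008, Thm 2.4 (i) p.19] -/
noncomputable def isoH1 :
    H1 (Rep.ofMulDistribMulAction X₁.HA (Mu N X₁.O)) ≃+ H1 (Rep.ofMulDistribMulAction X₂.HA (Mu N X₂.O)) :=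
  (e.h1Iso N).symm.toLinearEquiv.toAddEquiv

/-- The coefficient morphism `res (μ_N(A₁)) → μ_N(A₂)` over `(H₂)_{A₂} → (H₁)_{A₁}` underlying
`isoH1`. [cite: MochizukiFrdII2008, Thm 2.4 (i) p.19] -/
noncomputable def muRepHom :
    Rep.res (e.isoHA.symm : X₂.HA →* X₁.HA) (Rep.ofMulDistribMulAction X₁.HA (Mu N X₁.O)) ⟶
      Rep.ofMulDistribMulAction X₂.HA (Mu N X₂.O) :=
  Rep.ofHom
    { toLinearMap := (e.muAddLinearEquiv N).symm.toLinearMap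
      isIntertwining' := fun g => by
        apply LinearMap.ext
        intro (x : Additive (Mu N X₁.O))
        show Additive.ofMul (e.muIso N (Additive.toMul (Additive.ofMul
            ((((e.isoHA.symm g) : X₁.HA) : X₁.AutE) • Additive.toMul x)))) =
          Additive.ofMul (((g : X₂.HA) : X₂.AutE) • Additive.toMul (Additive.ofMul
            (e.muIso N (Additive.toMul x))))
        rw [toMul_ofMul, toMul_ofMul, muIso_smul, coe_isoHA_symm, MulEquiv.apply_symm_apply] }

/-- `isoH1` is the map on `H¹` induced by `((H₂)_{A₂} → (H₁)_{A₁}, μ_N(A₁) → μ_N(A₂))`.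
[cite: MochizukiFrdII2008, Thm 2.4 (i) p.19] -/
theorem isoH1_apply (x : H1 (Rep.ofMulDistribMulAction X₁.HA (Mu N X₁.O))) :
    e.isoH1 N x = (groupCohomology.map (e.isoHA.symm : X₂.HA →* X₁.HA) (e.muRepHom N) 1).hom x :=
  rfl

/-- `isoH1` on the class of a 1-cocycle `c` is the class of the transported cocycle
`k ↦ muIso (c (isoHA⁻¹ k))`. [cite: MochizukiFrdII2008, Thm 2.4 (i) p.19] -/
theorem isoH1_H1π (c : cocycles₁ (Rep.ofMulDistribMulAction X₁.HA (Mu N X₁.O))) :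
    e.isoH1 N (H1π _ c) =
      H1π _ (mapCocycles₁ (e.isoHA.symm : X₂.HA →* X₁.HA) (e.muRepHom N) c) := by
  rw [isoH1_apply]
  exact H1π_comp_map_apply _ _ c

/-! ### `(N, H)`-saturation and `F_N` transport -/

/-- `(H₁)_{A₁} ⥲ (H₂)_{A₂}` as a continuous homomorphism (discrete groups).
[cite: MochizukiFrdII2008, Thm 2.4 (i) p.19] -/
noncomputable def haHom : X₁.HA →ₜ* X₂.HA :=
  { e.isoHA.toMonoidHom with continuous_toFun := continuous_of_discreteTopology }

/-- `(H₂)_{A₂} ⥲ (H₁)_{A₁}` as a continuous homomorphism. [cite: MochizukiFrdII2008, Thm 2.4 (i) p.19] -/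
noncomputable def haInv : X₂.HA →ₜ* X₁.HA :=
  { e.isoHA.symm.toMonoidHom with continuous_toFun := continuous_of_discreteTopology }

/-- `haHom` is `isoHA`. [cite: MochizukiFrdII2008, Thm 2.4 (i) p.19] -/
@[simp] theorem haHom_apply (h : X₁.HA) : e.haHom h = e.isoHA h := rfl

/-- `haInv` is `isoHA⁻¹`. [cite: MochizukiFrdII2008, Thm 2.4 (i) p.19] -/
@[simp] theorem haInv_apply (h : X₂.HA) : e.haInv h = e.isoHA.symm h := rfl

/-- `H₁ ⥲ H₂` (restriction of `G₁ ⥲ G₂`) as a continuous homomorphism.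
[cite: MochizukiFrdII2008, Thm 2.4 (i) p.19] -/
def hHom : X₁.H →ₜ* X₂.H where
  toFun h := ⟨e.isoG (h : X₁.G), (e.isoG_mem_H_iff _).mpr h.2⟩
  map_one' := Subtype.ext (by simp)
  map_mul' a b := Subtype.ext (by simp)
  continuous_toFun := (e.isoG.continuous.comp continuous_subtype_val).subtype_mk _

/-- `H₂ ⥲ H₁` as a continuous homomorphism. [cite: MochizukiFrdII2008, Thm 2.4 (i) p.19] -/
def hInv : X₂.H →ₜ* X₁.H where
  toFun h := ⟨e.isoG.symm (h : X₂.G), e.isoG_symm_mem_H h.2⟩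
  map_one' := Subtype.ext (by simp)
  map_mul' a b := Subtype.ext (by simp)
  continuous_toFun := (e.isoG.symm.continuous.comp continuous_subtype_val).subtype_mk _

/-- `hHom` on underlying elements. [cite: MochizukiFrdII2008, Thm 2.4 (i) p.19] -/
@[simp] theorem coe_hHom (h : X₁.H) : ((e.hHom h : X₂.H) : X₂.G) = e.isoG h := rfl

/-- `hInv` on underlying elements. [cite: MochizukiFrdII2008, Thm 2.4 (i) p.19] -/
@[simp] theorem coe_hInv (h : X₂.H) : ((e.hInv h : X₁.H) : X₁.G) = e.isoG.symm h := rfl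

/-- The square `H₁ ↠ (H₁)_{A₁} ⥲ (H₂)_{A₂}` = `H₁ ⥲ H₂ ↠ (H₂)_{A₂}` (from `outer₂ ∘ isoG = isoE ∘ outer₁`).
[cite: MochizukiFrdII2008, Thm 2.4 (i) p.19] -/
theorem qHA_hHom (h : X₁.H) : X₂.qHA (e.hHom h) = e.haHom (X₁.qHA h) :=
  Subtype.ext (by
    show X₂.outer ((e.hHom h : X₂.H) : X₂.G) = ((e.isoHA (X₁.qHA h) : X₂.HA) : X₂.AutE)
    rw [coe_hHom, e.outer_isoG, coe_isoHA]
    rfl)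

/-- **Transport data for `μ_N`** between `(H₁ ↠ (H₁)_{A₁}, μ_N(A₁))` and `(H₂ ↠ (H₂)_{A₂}, μ_N(A₂))`.
[cite: MochizukiFrdII2008, Thm 2.4 (i) p.19] -/
noncomputable def transportMu :
    InflTransport₂ X₁.qHA X₂.qHA (muTopRep N X₁.O X₁.HA) (muTopRep N X₂.O X₂.HA) where
  e := e.haHom
  e' := e.haInv
  e'_e x := by simp
  e_e' x := by simp
  d := e.hHom
  d' := e.hInv
  d'_d x := Subtype.ext (by simp)
  d_d' x := Subtype.ext (by simp)
  q'_d h := e.qHA_hHom h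
  f := TopRep.ofHom
    { toContinuousLinearMap :=
        (⟨(e.muAddLinearEquiv N).toLinearMap, continuous_of_discreteTopology⟩ :
          Additive (Mu N X₂.O) →L[ℤ] Additive (Mu N X₁.O))
      isIntertwining' := fun k => by
        apply ContinuousLinearMap.ext
        intro (x : Additive (Mu N X₂.O))
        show Additive.ofMul ((e.muIso N).symm (Additive.toMul (Additive.ofMul
            (((e.isoHA k : X₂.HA) : X₂.AutE) • Additive.toMul x)))) =
          Additive.ofMul (((k : X₁.HA) : X₁.AutE) • Additive.toMul (Additive.ofMul
            ((e.muIso N).symm (Additive.toMul x))))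
        rw [toMul_ofMul, toMul_ofMul, muIso_symm_smul, coe_isoHA, MulEquiv.symm_apply_apply] }
  f' := TopRep.ofHom
    { toContinuousLinearMap :=
        (⟨(e.muAddLinearEquiv N).symm.toLinearMap, continuous_of_discreteTopology⟩ :
          Additive (Mu N X₁.O) →L[ℤ] Additive (Mu N X₂.O))
      isIntertwining' := fun k => by
        apply ContinuousLinearMap.ext
        intro (x : Additive (Mu N X₁.O))
        show Additive.ofMul (e.muIso N (Additive.toMul (Additive.ofMul
            (((e.isoHA.symm k : X₁.HA) : X₁.AutE) • Additive.toMul x)))) =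
          Additive.ofMul (((k : X₂.HA) : X₂.AutE) • Additive.toMul (Additive.ofMul
            (e.muIso N (Additive.toMul x))))
        rw [toMul_ofMul, toMul_ofMul, muIso_smul, coe_isoHA_symm, MulEquiv.apply_symm_apply] }
  f'_f x := by
    show Additive.ofMul (e.muIso N (Additive.toMul (Additive.ofMul
        ((e.muIso N).symm (Additive.toMul x))))) = x
    rw [toMul_ofMul, MulEquiv.apply_symm_apply, ofMul_toMul]
  f_f' x := by
    show Additive.ofMul ((e.muIso N).symm (Additive.toMul (Additive.ofMul
        (e.muIso N (Additive.toMul x))))) = x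
    rw [toMul_ofMul, MulEquiv.symm_apply_apply, ofMul_toMul]

/-- **Transport data for `ℤ/Nℤ`** (identity on coefficients). [cite: MochizukiFrdII2008, Thm 2.4 (i) p.19] -/
noncomputable def transportTriv :
    InflTransport₂ X₁.qHA X₂.qHA (trivTopRep N X₁.HA) (trivTopRep N X₂.HA) where
  e := e.haHom
  e' := e.haInv
  e'_e x := by simp
  e_e' x := by simp
  d := e.hHom
  d' := e.hInv
  d'_d x := Subtype.ext (by simp)
  d_d' x := Subtype.ext (by simp)
  q'_d h := e.qHA_hHom h
  f := TopRep.ofHom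
    { toContinuousLinearMap := ContinuousLinearMap.id ℤ (ZMod N)
      isIntertwining' := fun k => by ext x; rfl }
  f' := TopRep.ofHom
    { toContinuousLinearMap := ContinuousLinearMap.id ℤ (ZMod N)
      isIntertwining' := fun k => by ext x; rfl }
  f'_f x := rfl
  f_f' x := rfl

include e in
/-- **Theorem 2.4 (i): "`Ψ` maps `(N, H₁)`-saturated objects to `(N, H₂)`-saturated objects"** — for
the typed contexts: `A₁` is `(N, H₁)`-saturated iff `A₂` is `(N, H₂)`-saturated, along a context
isomorphism ((a) `μ_N`-saturation via `muIso`; (b) Galois by `isGalois_iff`; (c) by the inflation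
square). [cite: MochizukiFrdII2008, Thm 2.4 (i) p.19] -/
theorem isNHSaturated_iff : IsNHSaturated X₁ N ↔ IsNHSaturated X₂ N := by
  have hc := isCohSaturated_iff_of_transport N X₁.O X₂.O X₁.HA X₂.HA X₁.qHA X₂.qHA
    (e.transportMu N) (e.transportTriv N)
  constructor
  · rintro ⟨⟨⟨a⟩⟩, b, c⟩
    exact ⟨⟨⟨((e.muIso N).symm.trans a)⟩⟩, e.isGalois_iff.mp b, hc.mp c⟩
  · rintro ⟨⟨⟨a⟩⟩, b, c⟩
    exact ⟨⟨⟨(e.muIso N).trans a⟩⟩, e.isGalois_iff.mpr b, hc.mpr c⟩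

/-- **Theorem 2.4 (i)**, the isomorphism `F_N(A₁) ⥲ F_N(A₂)` induced by the context isomorphism.
[cite: MochizukiFrdII2008, Thm 2.4 (i) p.19] -/
noncomputable def isoFN : FN X₁ N ≃+ FN X₂ N := (e.transportMu N).fnEquiv.symm

/-- `isoFN⁻¹` on the class of `x ∈ H²((H₂)_{A₂}, μ_N(A₂))` is the class of its transport `pull x`.
[cite: MochizukiFrdII2008, Thm 2.4 (i) p.19] -/
theorem isoFN_symm_mk (x : continuousCohomology 2 (muTopRep N X₂.O X₂.HA)) :
    (e.isoFN N).symm (x : FN X₂ N) =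
      ((((e.transportMu N).pull 2).hom x : continuousCohomology 2 (muTopRep N X₁.O X₁.HA)) :
        FN X₁ N) :=
  rfl

/-- `isoFN` on the class of `y ∈ H²((H₁)_{A₁}, μ_N(A₁))` is the class of its transport `push y`.
[cite: MochizukiFrdII2008, Thm 2.4 (i) p.19] -/
theorem isoFN_mk (y : continuousCohomology 2 (muTopRep N X₁.O X₁.HA)) :
    e.isoFN N (y : FN X₁ N) =
      ((((e.transportMu N).push 2).hom y : continuousCohomology 2 (muTopRep N X₂.O X₂.HA)) :
        FN X₂ N) := by
  apply (e.isoFN N).symm.injective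
  rw [AddEquiv.symm_apply_apply, isoFN_symm_mk, (e.transportMu N).pull_push_apply 2 y]

/-! ### The comparison data of Theorem 2.4 (i) and the Kummer compatibility -/

/-- **Theorem 2.4 (i), the comparison data induced by the context isomorphism**: the `Thm24Data` of
`PadicKummerSetting.lean` with `O^□(A₁) ⥲ O^□(A₂)`, `(H₁)_{A₁} ⥲ (H₂)_{A₂}`, `(G₁)_{A₁} ⥲ (G₂)_{A₂}`,
`H¹ ⥲ H¹`, `F_N ⥲ F_N` all CONSTRUCTED ("manifestly group-theoretic/category-theoretic", proof of
Thm. 2.4 (i) p. 20). [cite: MochizukiFrdII2008, Thm 2.4 (i) p.19] -/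
noncomputable def thm24Data : Thm24Data X₁ X₂ N where
  isoG := e.isoG
  mapsH := e.map_H
  isoO := e.isoO
  isoHA := e.isoHA
  isoGA := e.isoGA
  equivariant h x := by rw [e.isoO_smul, coe_isoHA]
  isoH1 := e.isoH1 N
  isoFN := e.isoFN N

/-- **Theorem 2.4 (i), compatibility with the Kummer maps** (FrdII p. 19: the induced isomorphisms
"are compatible with the respective Kummer … maps `O^□(Aᵢ)^{Hᵢ} → H¹((Hᵢ)_{Aᵢ}, μ_N(Aᵢ))`"): the
transported Kummer class of `f` is the Kummer class of the transported element — PROVED at the level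
of cocycles (an `N`-th root `g` of `f` goes to the `N`-th root `isoO g` of `isoO f`, and
`h • g = ζ_h g` goes to `isoHA h • isoO g = muIso ζ_h · isoO g`).
[cite: MochizukiFrdII2008, Thm 2.4 (i) p.19] -/
theorem isoH1_kummerClass (hO₁ : NthRootsDifferByUnits N X₁.O) (hO₂ : NthRootsDifferByUnits N X₂.O)
    (f₁ : kummerDomain N X₁.O X₁.HA) (f₂ : kummerDomain N X₂.O X₂.HA)
    (hf : (f₂ : X₂.O) = e.isoO f₁) :
    e.isoH1 N (kummerClass hO₁ X₁.HA f₁) = kummerClass hO₂ X₂.HA f₂ := by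
  obtain ⟨g₁, hg₁⟩ := f₁.2.2
  have hg₂ : (e.isoO g₁) ^ N = (f₂ : X₂.O) := by rw [← map_pow, hg₁, hf]
  rw [kummerClass_eq hO₁ X₁.HA f₁ hg₁, kummerClass_eq hO₂ X₂.HA f₂ hg₂, kummerClassOfRoot,
    kummerClassOfRoot, isoH1_H1π]
  congr 1
  refine cocycles₁_ext fun k => ?_
  rw [coe_mapCocycles₁]
  change Additive.ofMul (e.muIso N (kummerCocycle hO₁ X₁.HA hg₁ f₁.2.1 (e.isoHA.symm k))) =
    Additive.ofMul (kummerCocycle hO₂ X₂.HA hg₂ f₂.2.1 k)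
  congr 1
  symm
  apply kummerCocycle_eq_of_smul_eq hO₂ X₂.HA hg₂ f₂.2.1 k
  have hk : (k : X₂.AutE) = e.isoE ((e.isoHA.symm k : X₁.HA) : X₁.AutE) := by
    rw [coe_isoHA_symm, MulEquiv.apply_symm_apply]
  rw [hk, ← e.isoO_smul, smul_root_eq hO₁ X₁.HA hg₁ f₁.2.1 (e.isoHA.symm k), map_mul,
    coe_val_muIso]

end Def22Context.Iso

end PadicKummer

end Literature.AlgebraicGeometry.Frobenioids
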